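import Summits.QuantumFields.YangMills.Theorems.FluctuationComparisonRegPrIntLS2BetaFibreGrowth
import HarnessLib

/-!
# GAP♯ ⊕ (T2-SHIFT) ⇒ TRANSVERSAL GROWTH OF THE ACTION AT A SHIFTED TUBE POINT — the `hgrowT` row of DET-REP-A at every path point

Definition-free helper for LINE g18-1 `Cruxes/FluctuationComparisonRegPrIntL/Lines/semiclassical_s2beta.lean` (crux `stmt-QuantumFields-20520`), v11∕v11.1 docking
(LINE-OWNER RULING (W3) (2)).  w5-20520 g14's ✓`…S2BetaDetRepAEdge.detRepA_edge` displays, at every point `y s` of an edge, the TRANSVERSAL GROWTH row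
`c₁‖v‖² ≤ A(c.Φ(x s, σ(y s + v))) − A(c.Φ(x s, σ(y s)))` near `v = 0`; v11.0's `EdgeRows` displays it too.  It is GAP♯ ∘ (T2-SHIFT) ∘ px11 g10: px21 g11's
✓`…S2BetaTransversalShift.offPivot_transversal_shift` (p748520) gives the off-pivot quadratic transversality of the tube at the base `σ y₁`,
`c‖v‖² ≤ ⨅_{w residual} Σ_{ℓ ∉ piv} dist1 (σ (y₁+v) ℓ · ((w • σ y₁) ℓ)⁻¹)²`, and px11 g10's ✓`…S2BetaFibreGrowth.growth_of_offPivot_orbitDist_le` turns an off-pivot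
orbit distance to the orbit of a fibre minimiser into excess action via GAP♯.  THIS FILE glues them at a SHIFTED point: the fibre minimiser over the moved datum
is the CHART VALUE `U₁ := Φ (V, σ y₁)` of the tube point, which agrees with `σ y₁` OFF the pivots, so the two orbit distances coincide termwise; the event
`Φ (V, σ (y₁+v)) ∈ Sf` holds for small `v` by the relative openness of the charted event in the carrier and the local-carrier row.

* ★★ `growth_at_tubePoint` — abstract chart `(Φ)` with off-pivot agreement, fibre row and relative openness on the carrier `Xc`; continuous `σ` with local carrier
  at `y₁`; `Φ (V, σ y₁)` a minimising `Sf`-history (`∈ Sf`, action `m`); GAP♯ at the datum for it (constant `μ′`); ANY off-pivot transversality row with constant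
  `c` at the base `σ y₁` (the CONCLUSION shape of ✓`offPivot_transversal_shift`, so this file does not depend on the frame `eV`) ⟹
  `∀ᶠ v in 𝓝 0, (μ′·c)·‖v‖² ≤ A(Φ (V, σ (y₁+v))) − A(Φ (V, σ y₁))`.

HONEST: bookkeeping over landed letters; proves NO stub of the line — EXW, GAP♯, DET-REP-B, H4ᶜ, LFR♯ᶜ, S2β and crux 20520 stay OPEN; rung R3 (YM₃ on T³) is NOT
d = 4, NOT infinite volume, NOT a mass gap, NOT Clay; the Yang–Mills mass gap is NOT proved.
-/

noncomputable section

open MeasureTheory Filter Topology Set Function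
open Literature.MathematicalPhysics.QuantumFieldTheory.Balaban1983to89
open Literature.MathematicalPhysics.QuantumFieldTheory.Balaban1983to89.T3ContinuumYM3Torus
open Literature.MathematicalPhysics.QuantumFieldTheory.Balaban1983to89.T3UnitLawDensityEML
open Literature.MathematicalPhysics.QuantumFieldTheory.Balaban1983to89.T3UnitScaleTilt
open Literature.MathematicalPhysics.QuantumFieldTheory.Balaban1983to89.T3TiltDescent
open Literature.MathematicalPhysics.QuantumFieldTheory.Balaban1983to89.T3ConstrainedMinimiser (fibre)
open Literature.MathematicalPhysics.QuantumFieldTheory.Balaban1983to89.T4Continuum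
open scoped Literature.MathematicalPhysics.QuantumFieldTheory.Balaban1983to89.T3OrbitAverage
open Summit.QuantumFields.YangMills.Theorems.FluctuationComparisonRegPrIntLWregChain (iterCentralBond)
open Summit.QuantumFields.YangMills.Theorems.FluctuationComparisonRegPrIntLS2BetaResidualGauge
open Summit.QuantumFields.YangMills.Theorems.FluctuationComparisonRegPrIntLS2BetaFibreGrowth

namespace Summit.QuantumFields.YangMills.Theorems.FluctuationComparisonRegPrIntLS2BetaGrowthShift

variable (F : T3Family) {J K : ℕ} (hJK : J ≤ K)

/-- ★★ **TRANSVERSAL GROWTH AT A SHIFTED TUBE POINT FROM GAP♯ AND OFF-PIVOT TRANSVERSALITY.**  Chart `Φ` over the datum `V` with, on the carrier `Xc`, off-pivot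
agreement, the fibre row and the relative openness of the event `Φ (V, ·) ∈ Sf`; a continuous transversal `σ : ℝ^{dV} → fields` with `σ y ∈ Xc` for `y` near `y₁`;
the chart value `Φ (V, σ y₁) ∈ Sf` with action `m`; GAP♯ at `V` for that minimiser with constant `μ′ > 0`; and off-pivot quadratic transversality of the family
`v ↦ σ (y₁ + v)` to the residual orbit of `σ y₁` with ANY constant `c` (✓`…S2BetaTransversalShift.offPivot_transversal_shift` gives `c > 0`).  Then
`(μ′·c)·‖v‖² ≤ A(Φ (V, σ (y₁ + v))) − A(Φ (V, σ y₁))` for `v` near `0` — ✓`detRepA_edge`'s `hgrowT` row at the path point.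
[cite: Balaban1985Variational, Thm 1 (8)-(10) p.279 and (142) p.299; Balaban1987RG1, (0.4) p.253 and (2.10) p.267] -/
theorem growth_at_tubePoint
    (Φ : GaugeField (F.P J) 0 (Matrix.specialUnitaryGroup (Fin 2) ℂ) × GaugeField (F.P K) 0 (Matrix.specialUnitaryGroup (Fin 2) ℂ) →
      GaugeField (F.P K) 0 (Matrix.specialUnitaryGroup (Fin 2) ℂ))
    {Sf : Set (GaugeField (F.P K) 0 (Matrix.specialUnitaryGroup (Fin 2) ℂ))}
    {V : GaugeField (F.P J) 0 (Matrix.specialUnitaryGroup (Fin 2) ℂ)} {m μ' : ℝ} (hμ' : 0 < μ')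
    {Xc : Set (GaugeField (F.P K) 0 (Matrix.specialUnitaryGroup (Fin 2) ℂ))}
    (hoff : ∀ z ∈ Xc, ∀ b, (∀ c, iterCentralBond (P := F.P K) (K - J) c ≠ b) → Φ (V, z) b = z b)
    (hfib : ∀ z ∈ Xc, descendTo F ℰp J K hJK (Φ (V, z)) = V)
    (hOrel : IsOpen ((Subtype.val : Xc → GaugeField (F.P K) 0 (Matrix.specialUnitaryGroup (Fin 2) ℂ)) ⁻¹' {z | Φ (V, z) ∈ Sf}))
    {dV : ℕ} {σ : EuclideanSpace ℝ (Fin dV) → GaugeField (F.P K) 0 (Matrix.specialUnitaryGroup (Fin 2) ℂ)} (hσ : Continuous σ)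
    {y₁ : EuclideanSpace ℝ (Fin dV)} (hσX : ∀ᶠ y in 𝓝 y₁, σ y ∈ Xc)
    (hS₁ : Φ (V, σ y₁) ∈ Sf) (hm₁ : wilsonAction4 (Φ (V, σ y₁)) = m)
    (hgap : ∀ U ∈ fibre F ℰp J K hJK V, U ∈ Sf →
      μ' * (⨅ w : {w : Site (F.P K) 0 → Matrix.specialUnitaryGroup (Fin 2) ℂ |
              ∀ U : GaugeField (F.P K) 0 (Matrix.specialUnitaryGroup (Fin 2) ℂ),
                descendTo F ℰp J K hJK (GaugeField.gaugeAct w U) = descendTo F ℰp J K hJK U},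
            ∑ ℓ : PBond (F.P K) 0,
              dist1 (U ℓ * ((GaugeField.gaugeAct (w : Site (F.P K) 0 → Matrix.specialUnitaryGroup (Fin 2) ℂ) (Φ (V, σ y₁))) ℓ)⁻¹) ^ 2)
        ≤ wilsonAction4 U - m)
    {c : ℝ}
    (hT2 : ∀ᶠ v in 𝓝 (0 : EuclideanSpace ℝ (Fin dV)),
      c * ‖v‖ ^ 2 ≤ ⨅ w : {w : Site (F.P K) 0 → Matrix.specialUnitaryGroup (Fin 2) ℂ |
            ∀ U : GaugeField (F.P K) 0 (Matrix.specialUnitaryGroup (Fin 2) ℂ),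
              descendTo F ℰp J K hJK (GaugeField.gaugeAct w U) = descendTo F ℰp J K hJK U},
          ∑ ℓ ∈ Finset.univ.filter (fun ℓ : PBond (F.P K) 0 => ∀ c', iterCentralBond (P := F.P K) (K - J) c' ≠ ℓ),
            dist1 (σ (y₁ + v) ℓ * ((GaugeField.gaugeAct (w : Site (F.P K) 0 → Matrix.specialUnitaryGroup (Fin 2) ℂ) (σ y₁)) ℓ)⁻¹) ^ 2) :
    ∀ᶠ v in 𝓝 (0 : EuclideanSpace ℝ (Fin dV)),
      (μ' * c) * ‖v‖ ^ 2 ≤ wilsonAction4 (Φ (V, σ (y₁ + v))) - wilsonAction4 (Φ (V, σ y₁)) := by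
  classical
  have hy₁X : σ y₁ ∈ Xc := hσX.self_of_nhds
  -- the family `v ↦ σ (y₁ + v)` tends to `σ y₁` and stays in the carrier
  have hshift : Tendsto (fun v : EuclideanSpace ℝ (Fin dV) => y₁ + v) (𝓝 0) (𝓝 y₁) := by
    have h : Tendsto (fun v : EuclideanSpace ℝ (Fin dV) => y₁ + v) (𝓝 0) (𝓝 (y₁ + 0)) := tendsto_const_nhds.add tendsto_id
    rwa [add_zero] at h
  have hσX' : ∀ᶠ v in 𝓝 (0 : EuclideanSpace ℝ (Fin dV)), σ (y₁ + v) ∈ Xc := hshift.eventually hσX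
  -- the charted event is relatively open in the carrier: it holds along the family near `0`
  obtain ⟨O', hO'open, hO'eq⟩ := isOpen_induced_iff.1 hOrel
  have hO'iff : ∀ z (hz : z ∈ Xc), z ∈ O' ↔ Φ (V, z) ∈ Sf := fun z hz => by
    have h := congrArg (fun s : Set Xc => (⟨z, hz⟩ : Xc) ∈ s) hO'eq
    exact Iff.of_eq h
  have hy₁O' : σ y₁ ∈ O' := (hO'iff (σ y₁) hy₁X).2 hS₁
  have hσO' : ∀ᶠ v in 𝓝 (0 : EuclideanSpace ℝ (Fin dV)), σ (y₁ + v) ∈ O' :=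
    ((hσ.tendsto y₁).comp hshift).eventually (hO'open.mem_nhds hy₁O')
  filter_upwards [hσX', hσO', hT2] with v hvX hvO hvT
  have hvS : Φ (V, σ (y₁ + v)) ∈ Sf := (hO'iff _ hvX).1 hvO
  -- off the pivots `(w • σ y₁) ℓ = (w • Φ (V, σ y₁)) ℓ`, so the transversality row reads on the orbit of the chart value
  have hsum : ∀ w : {w : Site (F.P K) 0 → Matrix.specialUnitaryGroup (Fin 2) ℂ |
        ∀ U : GaugeField (F.P K) 0 (Matrix.specialUnitaryGroup (Fin 2) ℂ),
          descendTo F ℰp J K hJK (GaugeField.gaugeAct w U) = descendTo F ℰp J K hJK U},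
      (∑ ℓ ∈ Finset.univ.filter (fun ℓ : PBond (F.P K) 0 => ∀ c', iterCentralBond (P := F.P K) (K - J) c' ≠ ℓ),
          dist1 (σ (y₁ + v) ℓ * ((GaugeField.gaugeAct (w : Site (F.P K) 0 → Matrix.specialUnitaryGroup (Fin 2) ℂ) (σ y₁)) ℓ)⁻¹) ^ 2) =
      ∑ ℓ ∈ Finset.univ.filter (fun ℓ : PBond (F.P K) 0 => ∀ c', iterCentralBond (P := F.P K) (K - J) c' ≠ ℓ),
          dist1 (σ (y₁ + v) ℓ * ((GaugeField.gaugeAct (w : Site (F.P K) 0 → Matrix.specialUnitaryGroup (Fin 2) ℂ) (Φ (V, σ y₁))) ℓ)⁻¹) ^ 2 := by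
    intro w
    refine Finset.sum_congr rfl fun ℓ hℓ => ?_
    have hℓ' : ∀ c', iterCentralBond (P := F.P K) (K - J) c' ≠ ℓ := (Finset.mem_filter.1 hℓ).2
    have hval : (GaugeField.gaugeAct (w : Site (F.P K) 0 → Matrix.specialUnitaryGroup (Fin 2) ℂ) (σ y₁)) ℓ =
        (GaugeField.gaugeAct (w : Site (F.P K) 0 → Matrix.specialUnitaryGroup (Fin 2) ℂ) (Φ (V, σ y₁))) ℓ := by
      show (w : Site (F.P K) 0 → Matrix.specialUnitaryGroup (Fin 2) ℂ) ℓ.src * σ y₁ ℓ * ((w : Site (F.P K) 0 → Matrix.specialUnitaryGroup (Fin 2) ℂ) ℓ.tgt)⁻¹ =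
        (w : Site (F.P K) 0 → Matrix.specialUnitaryGroup (Fin 2) ℂ) ℓ.src * Φ (V, σ y₁) ℓ * ((w : Site (F.P K) 0 → Matrix.specialUnitaryGroup (Fin 2) ℂ) ℓ.tgt)⁻¹
      rw [hoff (σ y₁) hy₁X ℓ hℓ']
    rw [hval]
  have hT2' : c * ‖v‖ ^ 2 ≤ ⨅ w : {w : Site (F.P K) 0 → Matrix.specialUnitaryGroup (Fin 2) ℂ |
        ∀ U : GaugeField (F.P K) 0 (Matrix.specialUnitaryGroup (Fin 2) ℂ),
          descendTo F ℰp J K hJK (GaugeField.gaugeAct w U) = descendTo F ℰp J K hJK U},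
      ∑ ℓ ∈ Finset.univ.filter (fun ℓ : PBond (F.P K) 0 => ∀ c', iterCentralBond (P := F.P K) (K - J) c' ≠ ℓ),
        dist1 (σ (y₁ + v) ℓ * ((GaugeField.gaugeAct (w : Site (F.P K) 0 → Matrix.specialUnitaryGroup (Fin 2) ℂ) (Φ (V, σ y₁))) ℓ)⁻¹) ^ 2 :=
    hvT.trans (le_of_eq (iInf_congr hsum))
  have h := growth_of_offPivot_orbitDist_le F hJK Φ hμ' hgap hoff hfib hvX hvS (t := c * ‖v‖ ^ 2) hT2'
  have hring : μ' * c * ‖v‖ ^ 2 = μ' * (c * ‖v‖ ^ 2) := by ring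
  rw [hring]
  linarith [h, hm₁]

end Summit.QuantumFields.YangMills.Theorems.FluctuationComparisonRegPrIntLS2BetaGrowthShift

end
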